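import Literature.Geometry.GeometricMeasureTheory.AreaFormulaLimits
import Mathlib.Topology.PartitionOfUnity
import Mathlib.Topology.EMetricSpace.Paracompact
import HarnessLib

/-!
# Hausdorff integrals of test functions converge under local graph convergence

Topic `Literature/Geometry/GeometricMeasureTheory` (continuation of `AreaFormulaLimits.lean`).
Let `Sₖ, S ⊆ V` be subsets of a real inner product space which, on each of finitely
many open sets `Wᵢ`, are images of a common bounded open parameter domain `Dᵢ ⊆ P` (`dim P = n`)
under injective `C¹` immersions `gᵢₖ → gᵢ` converging pointwise on `Dᵢ` together with their
derivatives (eventually uniformly bounded): `Sₖ ∩ Wᵢ = gᵢₖ(Dᵢ) ∩ Wᵢ`, `S ∩ Wᵢ = gᵢ(Dᵢ) ∩ Wᵢ`.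
Then for every bounded continuous `φ : V → ℝ`, `φ ≥ 0`, with `tsupport φ ⊆ ⋃ᵢ Wᵢ`,

  `∫_{Sₖ} φ d𝓗ⁿ → ∫_S φ d𝓗ⁿ`  (`tendsto_setLIntegral_of_localGraphs`, `𝓗ⁿ = μHE[n]`, the
  integrals as lower Lebesgue integrals of `ENNReal.ofReal ∘ φ`),

by a partition of unity subordinate to the `Wᵢ` and the single-patch statement
`tendsto_lintegral_image_of_tendsto`.  This is the vague convergence of the area measures of
locally `C¹`-converging submanifolds, the input (with uniform Gaussian tails,
`Geometry/Riemannian/GaussianAreaLimits.lean`) for passing Gaussian density ratios to blow-up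
limits (White 2005, proof of Thm. 3.1, (6) on p. 1498).

Everything is PROVED; no definitions, no named facts.

## References

* H. Federer, *Geometric Measure Theory*, Springer 1969, 3.2.3, 3.2.5. [Federer1969]
* B. White, *A local regularity theorem for mean curvature flow*, Ann. of Math. 161 (2005),
  proof of Thm. 3.1, p. 1498. [White2005]
-/

open scoped ENNReal NNReal Topology
open Set Filter Function MeasureTheory MeasureTheory.Measure Module

noncomputable section

namespace Literature.Geometry.GeometricMeasureTheory

variable {P V : Type*} [NormedAddCommGroup P] [InnerProductSpace ℝ P] [FiniteDimensional ℝ P]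
  [MeasurableSpace P] [BorelSpace P]
  [NormedAddCommGroup V] [InnerProductSpace ℝ V] [MeasurableSpace V] [BorelSpace V]

omit [NormedAddCommGroup V] [InnerProductSpace ℝ V] [BorelSpace V] in
/-- A function vanishing off `W` integrates over `A` as over `A ∩ W`. [folklore] -/
theorem setLIntegral_eq_inter_of_eq_zero {μ : Measure V} {h : V → ℝ≥0∞} {W : Set V}
    (hW : MeasurableSet W) (h0 : ∀ y ∉ W, h y = 0) (A : Set V) :
    ∫⁻ y in A, h y ∂μ = ∫⁻ y in A ∩ W, h y ∂μ := by
  have hind : h = W.indicator h := by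
    funext y
    by_cases hy : y ∈ W
    · rw [indicator_of_mem hy]
    · rw [indicator_of_notMem hy, h0 y hy]
  conv_lhs => rw [hind]
  rw [lintegral_indicator hW, Measure.restrict_restrict hW, inter_comm]

/-- **Hausdorff integrals of test functions converge under local graph convergence** (vague
convergence of the area measures). See the module docstring for the hypotheses.
[cite: Federer1969, 3.2.5] [cite: White2005, proof of Thm. 3.1, p. 1498] -/
theorem tendsto_setLIntegral_of_localGraphs {ι : Type*} [Fintype ι]
    {W : ι → Set V} (hW : ∀ i, IsOpen (W i))
    {D : ι → Set P} (hD : ∀ i, IsOpen (D i)) (hDfin : ∀ i, volume (D i) ≠ ∞)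
    {gs : ι → ℕ → P → V} {gs' : ι → ℕ → P → P →L[ℝ] V} {g : ι → P → V}
    {g' : ι → P → P →L[ℝ] V}
    (hgs : ∀ i k, ∀ x ∈ D i, HasFDerivAt (gs i k) (gs' i k x) x)
    (hgs'c : ∀ i k, ContinuousOn (gs' i k) (D i))
    (hinjs : ∀ i k, InjOn (gs i k) (D i)) (himms : ∀ i k, ∀ x ∈ D i, Injective (gs' i k x))
    (hg : ∀ i, ∀ x ∈ D i, HasFDerivAt (g i) (g' i x) x) (hg'c : ∀ i, ContinuousOn (g' i) (D i))
    (hinj : ∀ i, InjOn (g i) (D i)) (himm : ∀ i, ∀ x ∈ D i, Injective (g' i x))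
    (hconv : ∀ i, ∀ x ∈ D i, Tendsto (fun k => gs i k x) atTop (𝓝 (g i x)))
    (hconv' : ∀ i, ∀ x ∈ D i, Tendsto (fun k => gs' i k x) atTop (𝓝 (g' i x)))
    {B : ℝ} (hB : ∀ i, ∀ᶠ k in atTop, ∀ x ∈ D i, ‖gs' i k x‖ ≤ B)
    {Ss : ℕ → Set V} {S : Set V}
    (hSs : ∀ i k, Ss k ∩ W i = gs i k '' D i ∩ W i) (hS : ∀ i, S ∩ W i = g i '' D i ∩ W i)
    {φ : V → ℝ} (hφ : Continuous φ) (hφ0 : ∀ y, 0 ≤ φ y) {G : ℝ} (hφG : ∀ y, φ y ≤ G)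
    (hsupp : tsupport φ ⊆ ⋃ i, W i) :
    Tendsto (fun k => ∫⁻ y in Ss k, ENNReal.ofReal (φ y) ∂(μHE[finrank ℝ P] : Measure V)) atTop
      (𝓝 (∫⁻ y in S, ENNReal.ofReal (φ y) ∂(μHE[finrank ℝ P] : Measure V))) := by
  -- a partition of unity on `tsupport φ` subordinate to the `Wᵢ`
  obtain ⟨ρ, hρ⟩ := PartitionOfUnity.exists_isSubordinate (isClosed_tsupport φ) W hW hsupp
  -- the pieces `φᵢ = φ ρᵢ`
  set ψ : ι → V → ℝ≥0∞ := fun i y => ENNReal.ofReal (φ y * ρ i y) with hψ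
  have hψc : ∀ i, Continuous (ψ i) := fun i =>
    ENNReal.continuous_ofReal.comp (hφ.mul (ρ i).continuous)
  have hψG : ∀ i y, ψ i y ≤ ENNReal.ofReal G := fun i y =>
    ENNReal.ofReal_le_ofReal ((mul_le_of_le_one_right (hφ0 y) (ρ.le_one i y)).trans (hφG y))
  have hψ0 : ∀ i, ∀ y ∉ W i, ψ i y = 0 := fun i y hy => by
    have h : ρ i y = 0 := by
      by_contra hne
      exact hy (hρ i (subset_tsupport _ (Function.mem_support.2 hne)))
    simp [hψ, h]
  -- `φ = Σᵢ ψᵢ`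
  have hsum : ∀ y, ENNReal.ofReal (φ y) = ∑ i, ψ i y := by
    intro y
    by_cases hy : y ∈ tsupport φ
    · have h1 : ∑ i, ρ i y = 1 := by
        have := ρ.sum_eq_one hy
        rwa [finsum_eq_sum_of_fintype] at this
      simp only [hψ]
      rw [← ENNReal.ofReal_sum_of_nonneg fun i _ => mul_nonneg (hφ0 y) (ρ.nonneg i y),
        ← Finset.mul_sum, h1, mul_one]
    · have h0 : φ y = 0 := image_eq_zero_of_notMem_tsupport hy
      simp [hψ, h0]
  have hmeasψ : ∀ i, Measurable (ψ i) := fun i => (hψc i).measurable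
  -- reduce to the pieces
  have hsplit : ∀ A : Set V, ∫⁻ y in A, ENNReal.ofReal (φ y) ∂(μHE[finrank ℝ P] : Measure V) =
      ∑ i, ∫⁻ y in A, ψ i y ∂(μHE[finrank ℝ P] : Measure V) := fun A => by
    rw [← lintegral_finsetSum' _ fun i _ => (hmeasψ i).aemeasurable]
    exact lintegral_congr fun y => hsum y
  simp only [hsplit]
  refine tendsto_finsetSum _ fun i _ => ?_
  -- a single piece lives on the patch `Wᵢ`
  have hWm : MeasurableSet (W i) := (hW i).measurableSet
  have hk : ∀ k, ∫⁻ y in Ss k, ψ i y ∂(μHE[finrank ℝ P] : Measure V) =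
      ∫⁻ y in gs i k '' D i, ψ i y ∂(μHE[finrank ℝ P] : Measure V) := fun k => by
    rw [setLIntegral_eq_inter_of_eq_zero hWm (hψ0 i) (Ss k), hSs i k,
      ← setLIntegral_eq_inter_of_eq_zero hWm (hψ0 i) (gs i k '' D i)]
  have hlim : ∫⁻ y in S, ψ i y ∂(μHE[finrank ℝ P] : Measure V) =
      ∫⁻ y in g i '' D i, ψ i y ∂(μHE[finrank ℝ P] : Measure V) := by
    rw [setLIntegral_eq_inter_of_eq_zero hWm (hψ0 i) S, hS i,
      ← setLIntegral_eq_inter_of_eq_zero hWm (hψ0 i) (g i '' D i)]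
  simp only [hk, hlim]
  exact tendsto_lintegral_image_of_tendsto (hD i) (hgs i) (hgs'c i) (hinjs i) (himms i) (hg i)
    (hg'c i) (hinj i) (himm i) (hD i).measurableSet Subset.rfl (hDfin i) (hconv i) (hconv' i)
    (hB i) (hψc i) ENNReal.ofReal_ne_top (hψG i)

end Literature.Geometry.GeometricMeasureTheory

end
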